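import Mathlib
import Summits.NavierStokesRegularity.NavierStokesRegularity.Theorems.EulerZoomLiouvillePowerGaugeEulerLiouvilleSelfSimilarTopBadNodeKernelGraph
import Summits.NavierStokesRegularity.NavierStokesRegularity.Theorems.EulerZoomLiouvillePowerGaugeEulerLiouvilleSelfSimilarTopBadNodeGraphBounds
import Summits.NavierStokesRegularity.NavierStokesRegularity.Theorems.EulerZoomLiouvillePowerGaugeEulerLiouvilleSelfSimilarTopBadNodeArcSpectral
import HarnessLib.Audit

/-!
# Rung C1 of the crux `EulerZoomLiouville.PowerGaugeEulerLiouville`: the KERNEL-GRAPH DATA PACKAGE at a degenerate node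
# (blueprint §3 — input of the no-exit lemma `false_of_topBadNode_of_graph`)

Route №10 `EulerZoomLiouville` (NavierStokesRegularity), crux E = stmt-NavierStokesRegularity-19832,
tenure rung C1 (exactly self-similar members), registered residue `stub_selfSimilarExtremal`.
Twenty-ninth file of the NODAL-CONTINUUM line (lineage ns-typeII-p1, gen 7).  `V = γ(y−c)+U` (`C²`), `z` a node with
`curl U(z) = 0` (so `A = DV(z)` is symmetric), `e` a unit kernel vector with `ker A = ℝe`.

* `exists_kernelGraph_data` — there are `δ > 0`, `L ≥ 0`, `C₁ > 0` and GLOBAL functions `g, g' : ℝ → ℝ³`, `φ : ℝ → ℝ`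
  with: `g(0) = 0`, `g ⊥ e`, `g` differentiable everywhere with derivative `g'`, `|g'(τ)| ≤ L|τ|` for `|τ| ≤ δ`;
  `V(z + τe + g(τ)) = φ(τ)e` for `|τ| ≤ δ`; `φ` continuous, `|φ(τ)| ≤ C₁τ²` and `φ` `C₁δ`-Lipschitz on `[−δ, δ]`.
  Construction: the kernel graph `Γ` of `exists_kernelGraph_of_corankOne` (bordered equivalence
  `borderedEquiv_of_isSymmetric`), `g₀ = Γ − z − σe`, `φ₀ = ⟪e, V∘Γ⟫` (`C²` on `(−δ₀, δ₀)`, `g₀'(0) = 0`,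
  `φ₀'(0) = ⟪e, Ae⟫ = 0`, `C^{1,1}` bounds by `exists_deriv_le_mul_abs_of_contDiffOn_two`), globalised by a smooth bump
  `χ` (`ContDiffBump`, `= 1` on `[−δ₀/4, δ₀/4]`, `= 0` off `(−3δ₀/8, 3δ₀/8)`): `g = χ•g₀`, `φ = χ·φ₀`, `δ = δ₀/8`.
* `exists_DU_oscillation` — small helper for the constants (appended).

WHAT THIS IS NOT: not NS, not E — packaging. [cite: ConstantinIgnatovaVicol2026Putative, §3.4.3–§3.5]
-/

noncomputable section

-- flat `Theorems/<Route><Decl>…` files of one crux share the namespace of the crux (tree convention)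
set_option linter.dupNamespace false

open Set Filter Topology Metric Function InnerProductSpace
open scoped RealInnerProductSpace NNReal

namespace Summit.NavierStokesRegularity.NavierStokesRegularity.Theorems.PowerGaugeEulerLiouville.NodalContinuum

open Literature.Analysis Literature.Analysis.FluidPDE Literature.Analysis.ODE

variable {γ C : ℝ} {c : EuclideanSpace ℝ (Fin 3)}
  {U : EuclideanSpace ℝ (Fin 3) → EuclideanSpace ℝ (Fin 3)} {P : EuclideanSpace ℝ (Fin 3) → ℝ}

set_option maxHeartbeats 800000 in
/-- **Kernel-graph data at a degenerate non-vortical node.**  See the module docstring.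
[cite: ConstantinIgnatovaVicol2026Putative, §3.4.3–§3.5 (local analysis not in print)] -/
theorem exists_kernelGraph_data (h : IsSelfSimilarEulerProfile γ c U P) {z : EuclideanSpace ℝ (Fin 3)}
    (hz : z ∈ selfSimilarNodalSet γ c U) (hΩz : curl U z = 0) {e : EuclideanSpace ℝ (Fin 3)} (he1 : ‖e‖ = 1)
    (hAe : fderiv ℝ (selfSimilarTransport γ c U) z e = 0)
    (hker : ∀ v, fderiv ℝ (selfSimilarTransport γ c U) z v = 0 → ⟪e, v⟫ = 0 → v = 0) :
    ∃ δ L C₁ : ℝ, ∃ g g' : ℝ → EuclideanSpace ℝ (Fin 3), ∃ φ : ℝ → ℝ,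
      0 < δ ∧ 0 ≤ L ∧ 0 < C₁ ∧ g 0 = 0 ∧ (∀ τ, ⟪e, g τ⟫ = 0) ∧ (∀ τ, HasDerivAt g (g' τ) τ) ∧
      (∀ τ, |τ| ≤ δ → ‖g' τ‖ ≤ L * |τ|) ∧
      (∀ τ, |τ| ≤ δ → selfSimilarTransport γ c U (z + τ • e + g τ) = φ τ • e) ∧
      Continuous φ ∧ (∀ τ, |τ| ≤ δ → |φ τ| ≤ C₁ * τ ^ 2) ∧
      (∀ τ τ', |τ| ≤ δ → |τ'| ≤ δ → |φ τ - φ τ'| ≤ C₁ * δ * |τ - τ'|) := by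
  set V := selfSimilarTransport γ c U with hV
  set A : EuclideanSpace ℝ (Fin 3) →L[ℝ] EuclideanSpace ℝ (Fin 3) := fderiv ℝ V z with hAdef
  have hVz : V z = 0 := hz
  have hV2 : ContDiff ℝ 2 V := by
    have e1 : V = fun y => γ • (y - c) + U y := rfl
    rw [e1]
    exact ((contDiff_id.sub contDiff_const).const_smul γ).add h.contDiff_velocity
  have hA : (A : EuclideanSpace ℝ (Fin 3) →ₗ[ℝ] EuclideanSpace ℝ (Fin 3)).IsSymmetric :=
    isSymmetric_fderiv_transport_of_curl_eq_zero h hΩz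
  have hee : ⟪e, e⟫ = 1 := by rw [real_inner_self_eq_norm_sq, he1]; norm_num
  obtain ⟨T, hT⟩ := borderedEquiv_of_isSymmetric hA hAe hker
  obtain ⟨δ₀, hδ₀, ρ₀, -, Γ, hΓ2, hΓ0, hΓ'0, hΓe, hΓV, -⟩ :=
    exists_kernelGraph_of_corankOne hV2 hVz he1 hAe T hT
  /- the raw functions -/
  set g₀ : ℝ → EuclideanSpace ℝ (Fin 3) := fun σ => Γ σ - z - σ • e with hg₀
  set φ₀ : ℝ → ℝ := fun σ => ⟪e, V (Γ σ)⟫ with hφ₀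
  have hopen : IsOpen (Ioo (-δ₀) δ₀) := isOpen_Ioo
  have hg₀2 : ContDiffOn ℝ 2 g₀ (Ioo (-δ₀) δ₀) :=
    (hΓ2.sub contDiffOn_const).sub (contDiffOn_id.smul contDiffOn_const)
  have hφ₀2 : ContDiffOn ℝ 2 φ₀ (Ioo (-δ₀) δ₀) :=
    contDiffOn_const.inner ℝ (hV2.comp_contDiffOn hΓ2)
  have hg₀d0 : deriv g₀ 0 = 0 := by
    have h1 : HasDerivAt g₀ (e - (1 : ℝ) • e) 0 :=
      (hΓ'0.sub_const z).sub ((hasDerivAt_id (0:ℝ)).smul_const e)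
    rw [h1.deriv]; simp
  have hφ₀d0 : deriv φ₀ 0 = 0 := by
    have hVd : HasFDerivAt V A z := by
      rw [hAdef]; exact ((hV2.differentiable (by norm_num)) z).hasFDerivAt
    have h1 : HasDerivAt (V ∘ Γ) (A e) 0 := hVd.comp_hasDerivAt_of_eq (0:ℝ) hΓ'0 hΓ0.symm
    have h2 : HasDerivAt φ₀ (⟪e, A e⟫ + ⟪(0 : EuclideanSpace ℝ (Fin 3)), (V ∘ Γ) 0⟫) 0 :=
      (hasDerivAt_const (0:ℝ) e).inner ℝ h1
    rw [h2.deriv, hAe, inner_zero_right, inner_zero_left, add_zero]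
  obtain ⟨L, hL, hg₀d, hg₀b⟩ := exists_deriv_le_mul_abs_of_contDiffOn_two hδ₀ hg₀2 hg₀d0
  obtain ⟨C₀, hC₀, hφ₀d, hφ₀b⟩ := exists_deriv_le_mul_abs_of_contDiffOn_two hδ₀ hφ₀2 hφ₀d0
  have hφ₀0 : φ₀ 0 = 0 := by simp [hφ₀, hΓ0, hVz]
  /- the bump -/
  let χ : ContDiffBump (0 : ℝ) := ⟨δ₀ / 4, 3 * δ₀ / 8, by positivity, by linarith⟩
  have hχ1 : ∀ τ : ℝ, |τ| ≤ δ₀ / 4 → (χ : ℝ → ℝ) τ = 1 := fun τ hτ =>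
    χ.one_of_mem_closedBall (by rw [mem_closedBall, dist_zero_right, Real.norm_eq_abs]; exact hτ)
  have hχ1' : ∀ τ : ℝ, |τ| < δ₀ / 4 → (χ : ℝ → ℝ) =ᶠ[𝓝 τ] 1 := fun τ hτ =>
    χ.eventuallyEq_one_of_mem_ball (by rw [mem_ball, dist_zero_right, Real.norm_eq_abs]; exact hτ)
  have hχ0 : ∀ τ : ℝ, 3 * δ₀ / 8 ≤ |τ| → (χ : ℝ → ℝ) τ = 0 := fun τ hτ =>
    χ.zero_of_le_dist (by rw [dist_zero_right, Real.norm_eq_abs]; exact hτ)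
  have hχ0' : ∀ τ : ℝ, 3 * δ₀ / 8 < |τ| → (χ : ℝ → ℝ) =ᶠ[𝓝 τ] 0 := by
    intro τ hτ
    have hop : IsOpen {σ : ℝ | 3 * δ₀ / 8 < |σ|} := isOpen_lt continuous_const continuous_abs
    exact Filter.eventuallyEq_of_mem (hop.mem_nhds hτ) fun σ hσ => hχ0 σ (le_of_lt hσ)
  have hχd : ∀ τ, HasDerivAt (χ : ℝ → ℝ) (deriv (χ : ℝ → ℝ) τ) τ := fun τ =>
    ((χ.contDiff (n := 1)).differentiable one_ne_zero τ).hasDerivAt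
  have hχd0 : ∀ τ : ℝ, |τ| < δ₀ / 4 → deriv (χ : ℝ → ℝ) τ = 0 := by
    intro τ hτ
    rw [(hχ1' τ hτ).deriv_eq]; exact deriv_const τ 1
  /- the global functions -/
  set g : ℝ → EuclideanSpace ℝ (Fin 3) := fun τ => (χ : ℝ → ℝ) τ • g₀ τ with hg
  set g' : ℝ → EuclideanSpace ℝ (Fin 3) := fun τ =>
    if |τ| < δ₀ / 2 then deriv (χ : ℝ → ℝ) τ • g₀ τ + (χ : ℝ → ℝ) τ • deriv g₀ τ else 0 with hg'
  set φ : ℝ → ℝ := fun τ => (χ : ℝ → ℝ) τ * φ₀ τ with hφ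
  have hδ : 0 < δ₀ / 8 := by positivity
  refine ⟨δ₀ / 8, L, C₀ + 1, g, g', φ, hδ, hL, by positivity, ?_, ?_, ?_, ?_, ?_, ?_, ?_, ?_⟩
  · -- g 0 = 0
    simp [hg, hg₀, hΓ0]
  · -- g ⊥ e
    intro τ
    by_cases hτ : |τ| < δ₀
    · have hmem : τ ∈ Ioo (-δ₀) δ₀ := by rw [mem_Ioo]; constructor <;> cases abs_lt.1 hτ <;> linarith
      simp only [hg, hg₀, inner_smul_right, inner_sub_right, hΓe τ hmem, hee]; ring
    · push Not at hτ
      simp only [hg, hχ0 τ (by linarith), zero_smul, inner_zero_right]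
  · -- derivative of g
    intro τ
    by_cases hτ : |τ| < δ₀ / 2
    · have h1 := ((hχd τ).smul (hg₀d τ hτ.le))
      simp only [hg', if_pos hτ]
      exact h1.congr_deriv (by rw [add_comm])
    · push Not at hτ
      have hev : g =ᶠ[𝓝 τ] fun _ => 0 := by
        filter_upwards [hχ0' τ (by linarith)] with σ hσ
        simp only [hg, hσ, Pi.zero_apply, zero_smul]
      simp only [hg', if_neg (not_lt.2 hτ)]
      exact (hasDerivAt_const τ (0 : EuclideanSpace ℝ (Fin 3))).congr_of_eventuallyEq hev
  · -- |g'| ≤ L|τ| on |τ| ≤ δ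
    intro τ hτ
    have hτ2 : |τ| < δ₀ / 2 := by linarith
    have hτ4 : |τ| < δ₀ / 4 := by linarith
    simp only [hg', if_pos hτ2, hχd0 τ hτ4, zero_smul, zero_add, hχ1 τ hτ4.le, one_smul]
    exact hg₀b τ hτ2.le
  · -- V on the graph
    intro τ hτ
    have hτ4 : |τ| ≤ δ₀ / 4 := by linarith
    have hmem : τ ∈ Ioo (-δ₀) δ₀ := by
      rw [mem_Ioo]; constructor <;> cases abs_le.1 hτ <;> linarith
    have e1 : z + τ • e + g τ = Γ τ := by simp only [hg, hχ1 τ hτ4, one_smul, hg₀]; abel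
    rw [e1, hΓV τ hmem]
    simp only [hφ, hχ1 τ hτ4, one_mul, hφ₀]
  · -- continuity of φ
    refine continuous_iff_continuousAt.2 fun τ => ?_
    by_cases hτ : |τ| < δ₀
    · have hmem : τ ∈ Ioo (-δ₀) δ₀ := by rw [mem_Ioo]; constructor <;> cases abs_lt.1 hτ <;> linarith
      have hφ₀c : ContinuousAt φ₀ τ := (hφ₀2.continuousOn.continuousWithinAt hmem).continuousAt (hopen.mem_nhds hmem)
      exact (χ.continuous.continuousAt).mul hφ₀c
    · push Not at hτ
      have hev : φ =ᶠ[𝓝 τ] fun _ => 0 := by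
        filter_upwards [hχ0' τ (by linarith)] with σ hσ
        simp only [hφ, hσ, Pi.zero_apply, zero_mul]
      exact (continuousAt_const.congr_of_eventuallyEq hev :)
  · -- |φ| ≤ C₁ τ²
    intro τ hτ
    have hτ2 : |τ| ≤ δ₀ / 2 := by linarith
    have h1 := norm_sub_le_mul_sq_of_deriv_le hC₀ hφ₀d hφ₀b hτ2
    rw [hφ₀0, sub_zero, Real.norm_eq_abs] at h1
    simp only [hφ, hχ1 τ (by linarith), one_mul]
    exact h1.trans (by nlinarith [sq_nonneg τ])
  · -- Lipschitz on [−δ, δ]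
    intro τ τ' hτ hτ'
    have hτ2 : |τ| ≤ δ₀ / 2 := by linarith
    have hτ'2 : |τ'| ≤ δ₀ / 2 := by linarith
    simp only [hφ, hχ1 τ (by linarith), hχ1 τ' (by linarith), one_mul]
    -- mean value on the segment
    have hseg : ∀ x ∈ Icc (min τ τ') (max τ τ'), |x| ≤ δ₀ / 8 := by
      intro x hx
      obtain ⟨hτa, hτb⟩ := abs_le.1 hτ
      obtain ⟨hτa', hτb'⟩ := abs_le.1 hτ'
      have hx1 := hx.1
      have hx2 := hx.2
      rw [abs_le]
      constructor
      · rcases min_choice τ τ' with hm | hm <;> rw [hm] at hx1 <;> linarith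
      · rcases max_choice τ τ' with hm | hm <;> rw [hm] at hx2 <;> linarith
    have hmv := (convex_Icc (min τ τ') (max τ τ')).norm_image_sub_le_of_norm_hasDerivWithin_le
      (f := φ₀) (f' := deriv φ₀) (C := (C₀ + 1) * (δ₀ / 8))
      (fun x hx => (hφ₀d x ((hseg x hx).trans (by linarith))).hasDerivWithinAt)
      (fun x hx => by
        have h1 := hφ₀b x ((hseg x hx).trans (by linarith))
        have h2 := hseg x hx
        nlinarith)
      (show τ' ∈ Icc (min τ τ') (max τ τ') from ⟨min_le_right _ _, le_max_right _ _⟩)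
      (show τ ∈ Icc (min τ τ') (max τ τ') from ⟨min_le_left _ _, le_max_left _ _⟩)
    rw [Real.norm_eq_abs, Real.norm_eq_abs] at hmv
    exact hmv

/-- The `DU`-oscillation radius: `2‖DU(y) − DU(z)‖ ≤ η` on a closed ball around `z` (continuity of `DU`). [folklore] -/
theorem exists_DU_oscillation (h : IsSelfSimilarEulerProfile γ c U P) (z : EuclideanSpace ℝ (Fin 3)) {η : ℝ}
    (hη : 0 < η) : ∃ δ > 0, ∀ y ∈ closedBall z δ, 2 * ‖fderiv ℝ U y - fderiv ℝ U z‖ ≤ η := by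
  have hc : Continuous (fderiv ℝ U) := h.contDiff_velocity.continuous_fderiv (by norm_num)
  obtain ⟨δ, hδ, hball⟩ := Metric.continuousAt_iff.1 hc.continuousAt (η / 2) (by positivity)
  refine ⟨δ / 2, by positivity, fun y hy => ?_⟩
  have h1 := hball (lt_of_le_of_lt (mem_closedBall.1 hy) (by linarith))
  rw [dist_eq_norm] at h1
  linarith

end Summit.NavierStokesRegularity.NavierStokesRegularity.Theorems.PowerGaugeEulerLiouville.NodalContinuum
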